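import Mathlib
import Literature.NumberTheory.LFunctions.WeilOddGroundState
import Summits.RiemannHypothesis.RiemannHypothesis.Theses.OddSector
import HarnessLib

/-!
# Sketch — crux-ideate round 2, ideator 5, crux `OddSector.OddOneSignedWindows` (stmt-RiemannHypothesis-17778)

Idea `prolate-seed-sign-from-energy`: in Connes' `𝓔`-seed coordinates the SIGN of the odd bottom state is
decided by RH-free structure (Poisson identity at the origin, seed zero at the fold point in the bulk,
band-tail slaved to the endpoint jump at the edge), so that one-signedness follows from a TWO-SIDED RELATIVE
ENERGY statement at the prolate scale (`TightBlock`).  This file only TYPES the first lemmas; nothing here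
is proved and nothing is registered (no `stub_*`).

* `TwoLevelProximity`  — the RH-free abstract first lemma (min–max algebra + the odd weak Euler–Lagrange
  identity): an odd unit window test `v` whose energy is within `δ·(ε₂−ε₁)` of the bottom has overlap
  `≥ 1 − δ` with the odd ground state.
* `sawtooth_bound`-shape statement `EdgeSawtooth` — the edge-margin constant `π/2 + 1`.
* `IsSincEigen`, `IsOddProlateSeed`, `IsOddProlateVector`, `IsOddProlateBlock` — an operator-free
  INTERFACE for the prolate functions `PS₂, PS₆, PS₁₀, …` of Slepian parameter `c = 2π e^{2a}` and
  Connes–Consani's odd prolate vectors `𝓔(φ_{2m+1})|_{[λ⁻¹,λ]}` (arXiv:2106.01715 §3), as predicates (no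
  existence smuggled: `OddProlateBlockExists` is the separate construction statement); `IsOddEnergyLB` is
  the junk-free lower semicontinuous energy of a non-smooth window function.
* `TightBlock` — the ONE RH-strength input of the line, typed: lower bounds for the two lowest odd levels
  relative to the explicit K-term prolate block, to relative precision `θ e^{-4a}` on the first level.
* `SignFromEnergy` — the statement of the RH-free shape theorem (schema), and the target implication
  `signFromEnergy_target`.
-/

noncomputable section

-- `Summit.RiemannHypothesis.RiemannHypothesis.…` repeats the summit name by design (D-0017 layout).
set_option linter.dupNamespace false

namespace Summit.RiemannHypothesis.RiemannHypothesis.Cruxes.OddOneSignedWindows.ProlateSeed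

open MeasureTheory Set Filter Real
open scoped Topology ComplexConjugate
open Literature.NumberTheory.LFunctions

/-! ## 0. Vocabulary: odd unit window tests, overlap, good window -/

/-- `h` is an `L²`-normalised smooth ODD test function supported in the window `[-a, a]`. -/
def IsOddUnitWindowTest (a : ℝ) (h : ℝ → ℂ) : Prop :=
  IsWeilTest h ∧ tsupport h ⊆ Icc (-a) a ∧ (∀ t, h (-t) = -h t) ∧ ∫ t, ‖h t‖ ^ 2 = (1 : ℝ)

/-- The `L²` pairing `⟨u, h⟩ = ∫ conj(u) h`. -/
def pair (u h : ℝ → ℂ) : ℂ := ∫ t, conj (u t) * h t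

/-- A GOOD WINDOW: one carrying an odd-sector ground state that is real and `≥ 0` a.e. on `(0, a)`
(the crux is `∀ A, ∃ a ≥ A, GoodWindow a`, `Iff.rfl` with the route decl, cf. Disproof.lean `crux_iff`). -/
def GoodWindow (a : ℝ) : Prop :=
  ∃ u : ℝ → ℂ, IsWeilOddGroundState a u ∧ ∀ᵐ t : ℝ, t ∈ Ioo 0 a → (u t).im = 0 ∧ 0 ≤ (u t).re

theorem crux_iff_goodWindow :
    Theses.OddSector.OddOneSignedWindows ↔ ∀ A : ℝ, ∃ a : ℝ, A ≤ a ∧ GoodWindow a := Iff.rfl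

/-! ## 1. FIRST LEMMA (RH-free): two-level proximity

If the odd levels above the bottom are `≥ m₂ > ε₁ = weilOddGroundEnergy a` on the orthocomplement of the
ground state `u`, then every odd unit window test `v` satisfies
`1 − |⟨u,v⟩|² ≤ (Re Q(v) − ε₁)/(m₂ − ε₁)`.
Proof sketch (not formalised here): write `v = ⟨u,v⟩u + w`, `w ⊥ u`; the odd weak Euler–Lagrange identity
(landed for this crux, `…OddOneSignedWindowsEulerLagrangeTransfer`, p150913) gives `Q(u,w) = ε₁⟨u,w⟩ = 0`,
so `Re Q(v) = |⟨u,v⟩|² ε₁ + Re Q(w) ≥ |⟨u,v⟩|² ε₁ + m₂ ‖w‖²` and `‖w‖² = 1 − |⟨u,v⟩|²`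
(`u` is only `L²`; the identity is used through the minimising sequence, as in RobustBarta.lean). -/
def TwoLevelProximity : Prop :=
  ∀ (a : ℝ) (u : ℝ → ℂ), IsWeilOddGroundState a u →
    ∀ m₂ : ℝ, weilOddGroundEnergy a < m₂ →
      (∀ h : ℝ → ℂ, IsOddUnitWindowTest a h → pair u h = 0 → m₂ ≤ (weilQuadratic h).re) →
        ∀ v : ℝ → ℂ, IsOddUnitWindowTest a v →
          1 - ‖pair u v‖ ^ 2 ≤
            ((weilQuadratic v).re - weilOddGroundEnergy a) / (m₂ - weilOddGroundEnergy a)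

/-! ## 2. The edge-margin constant (RH-free real analysis)

For a seed `φ = (ψ − ψ̂)/2` with `ψ` time-limited to `[−λ, λ]`, the band tail is slaved to the endpoint jump,
`ψ̂(ξ) ≈ 2ψ(λ⁻) sin(2πλξ)/(2πξ)`, so at the window edge `x → λ⁻` the competing terms `Σ_{n≥2} φ(nx)` are a
sawtooth sum bounded by `(π/2 + 1)/(2πλ) · |ψ(λ⁻)|`; the classical bound typed below is its constant. -/
def EdgeSawtooth : Prop :=
  ∀ θ : ℝ, |∑' n : ℕ, Real.sin ((n + 2 : ℕ) * θ) / ((n + 2 : ℕ) : ℝ)| ≤ Real.pi / 2 + 1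

/-! ## 3. Prolate interface (operator-free), Connes–Consani's odd prolate vector -/

/-- The sinc kernel of Slepian parameter `c` on `[-1, 1]` (value `c/π` on the diagonal). -/
def sincKernel (c x y : ℝ) : ℝ :=
  if x = y then c / Real.pi else Real.sin (c * (x - y)) / (Real.pi * (x - y))

/-- `ψ` is a real, continuous eigenfunction of the time–band limiting (sinc-kernel) operator on `[-1,1]`
with eigenvalue `μ`, EVEN, `L²([-1,1])`-normalised, with exactly `k` zeros in `(0, 1)` — for `k = 1, 3`
this pins (up to sign) the prolate spheroidal wave functions `PS_{2,0}(c,·)`, `PS_{6,0}(c,·)` and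
`μ = λ₂(c), λ₆(c)` (Slepian–Pollak 1961: the sinc operator commutes with the prolate Sturm–Liouville
operator, eigenvalues simple and strictly decreasing, `PS_{n,0}` has exactly `n` zeros in `(-1,1)`). -/
def IsSincEigen (c : ℝ) (k : ℕ) (ψ : ℝ → ℝ) (μ : ℝ) : Prop :=
  ContinuousOn ψ (Icc (-1) 1) ∧ (∀ x, ψ (-x) = ψ x) ∧ (∫ x in Icc (-1 : ℝ) 1, ψ x ^ 2 = 1) ∧
    (∀ x ∈ Icc (-1 : ℝ) 1, ∫ y in Icc (-1 : ℝ) 1, sincKernel c x y * ψ y = μ * ψ x) ∧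
    {x : ℝ | x ∈ Ioo (0 : ℝ) 1 ∧ ψ x = 0}.ncard = k ∧ {x : ℝ | x ∈ Ioo (0 : ℝ) 1 ∧ ψ x = 0}.Finite

/-- Connes–Consani's odd seeds `φ_{2m+1} = ψ_{2m+1} ψ₁(0) − ψ₁ ψ_{2m+1}(0)` rescaled to `[−λ, λ]` (their
`ψ₁ = PS₂`, `ψ_{2m+1} = PS_{4m+2}`, Slepian parameter `c = 2πλ²`; `PS_{4m+2}` is pinned as the even sinc
eigenfunction with exactly `2m+1` zeros in `(0,1)`), extended by `0` off `[−λ, λ]`; they vanish at `0` (the Poisson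
condition making `𝓔(φ)` odd under `x ↦ x⁻¹`, i.e. odd in `t = log x`). `m = 1` is the rung-6 seed `φ₃`. -/
def IsOddProlateSeed (lam : ℝ) (m : ℕ) (φ : ℝ → ℝ) : Prop :=
  ∃ (ψ₁ ψ : ℝ → ℝ) (μ₁ μ : ℝ), IsSincEigen (2 * Real.pi * lam ^ 2) 1 ψ₁ μ₁ ∧
    IsSincEigen (2 * Real.pi * lam ^ 2) (2 * m + 1) ψ μ ∧
    ∀ y, φ y = if |y| ≤ lam then ψ (y / lam) * ψ₁ 0 - ψ₁ (y / lam) * ψ 0 else 0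

/-- The ODD PROLATE VECTOR of rung `4m+2` at window `a = log λ`: in the additive variable `t = log x`,
`v(t) = N · [E(t) − E(−t)]/2` with `E(t) = e^{t/2} Σ_{n≥1} φ(n e^t)` (a FINITE sum for `t > -a`, since `φ` is
supported in `[−λ, λ]`), truncated to `[-a, a]`, `L²`-normalised (`N > 0`).  For `m = 1` this is the function
compared graphically with the true odd eigenvectors in arXiv:2106.01715 §3 (formula (ephirough)) and with the
hub's odd bottom state in BarrierNotes-r1-k2 (kit j023263). Stated as a predicate on `v`. -/
def IsOddProlateVector (a : ℝ) (m : ℕ) (v : ℝ → ℂ) : Prop :=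
  ∃ (φ : ℝ → ℝ) (N : ℝ), IsOddProlateSeed (Real.exp a) m φ ∧ 0 < N ∧
    (∀ t, v t = if |t| ≤ a then
        ((N / 2 * (Real.exp (t / 2) * ∑' n : ℕ, φ ((n + 1 : ℕ) * Real.exp t) -
          Real.exp (-t / 2) * ∑' n : ℕ, φ ((n + 1 : ℕ) * Real.exp (-t))) : ℝ) : ℂ) else 0) ∧
    ∫ t, ‖v t‖ ^ 2 = (1 : ℝ)

/-- An odd prolate BLOCK of size `K` at window `a`: the vectors of rungs `6, 10, …, 4K+2`
(no orthonormalisation needed: Ritz values depend only on the span). -/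
def IsOddProlateBlock (a : ℝ) (K : ℕ) (v : Fin K → ℝ → ℂ) : Prop :=
  ∀ i : Fin K, IsOddProlateVector a ((i : ℕ) + 1) (v i)

/-- CONSTRUCTION statement (separate from the interface, RH-free; Slepian–Pollak existence + the
normalisability `v ≠ 0`): every window `a > 0` carries an odd prolate block of every size. -/
def OddProlateBlockExists : Prop :=
  ∀ a : ℝ, 0 < a → ∀ K : ℕ, ∃ v : Fin K → ℝ → ℂ, IsOddProlateBlock a K v

/-- `R` is a LOWER BOUND for the closed (lsc) Weil energy of the window function `w` in the odd sector:
along every `L²`-approximating sequence of odd unit window tests the energies are eventually `≥ R − δ`.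
(Junk-free encoding of `R ≤ Q̄(w)` for non-smooth `w` such as prolate vectors, which jump at `±a`.) -/
def IsOddEnergyLB (a : ℝ) (w : ℝ → ℂ) (R : ℝ) : Prop :=
  ∀ g : ℕ → ℝ → ℂ, (∀ n, IsOddUnitWindowTest a (g n)) →
    Tendsto (fun n ↦ ∫ t, ‖g n t - w t‖ ^ 2) atTop (𝓝 0) →
      ∀ δ : ℝ, 0 < δ → ∀ᶠ n in atTop, R - δ ≤ (weilQuadratic (g n)).re

/-! ## 4. The ONE RH-strength input: two-sided block control at the prolate scale

`TightBlock θ Δ K a`: for every odd prolate block `v` of size `K` at window `a` and every `R` below the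
block's bottom Ritz value (i.e. `R` is an energy lower bound for EVERY unit vector of the span):
(i) LOWER RUNG — every smooth odd unit window test has `Re Q ≥ R/(1 + θ e^{-4a})` (the odd bottom energy is
    within the RELATIVE factor `1 + θ e^{-4a}` of the explicit block's bottom, from below);
(ii) GAP — odd unit window tests orthogonal to the block have `Re Q ≥ (1 + Δ) · ε₁`.
Upper bounds (`ε₁ ≤` block bottom) are free by min–max.  (i) with `R > 0` ⇒ `ε₁ > 0` ⇒ (antitonicity +
Yoshida's odd criterion, both in tree) RH — as every stub of every line for this crux must (`X → RH` is in
tree); RH does NOT give (i) or (ii) (they are two-sided frame inequalities for odd type-`a` Paley–Wiener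
functions on the zeta ordinates at the plunge height `2πe^{2a}`, relative to an explicit finite block), so no
`stub ↔ RH` costume certificate is available. -/
def TightBlock (θ Δ : ℝ) (K : ℕ) (a : ℝ) : Prop :=
  ∀ v : Fin K → ℝ → ℂ, IsOddProlateBlock a K v →
    ∀ R : ℝ, (∀ c : Fin K → ℂ, (∫ t, ‖∑ i, c i * v i t‖ ^ 2 = (1 : ℝ)) →
        IsOddEnergyLB a (fun t ↦ ∑ i, c i * v i t) R) →
      (∀ h : ℝ → ℂ, IsOddUnitWindowTest a h → R / (1 + θ * Real.exp (-4 * a)) ≤ (weilQuadratic h).re) ∧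
      (∀ h : ℝ → ℂ, IsOddUnitWindowTest a h → (∀ i, pair (v i) h = 0) →
        (1 + Δ) * weilOddGroundEnergy a ≤ (weilQuadratic h).re)

/-- Non-resonance of the window height: `a` keeps distance `≥ r` from every `log n`, `n ≥ 2`
(the resonant windows `a = log q` are bad: 2001 §10 cusp; in seed coordinates the truncation of the
`n = q` term sits at the fold point `x = 1` iff `e^a = q`). -/
def NonResonant (r a : ℝ) : Prop := ∀ n : ℕ, 2 ≤ n → r ≤ |a - Real.log n|

/-! ## 5. The RH-free SHAPE THEOREM (schema) and the target -/

/-- `SignFromEnergy θ Δ K r A`: at every non-resonant window `a ≥ A`, two-sided block control gives a good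
window.  Its proof plan (three zones in seed coordinates): bulk by `TwoLevelProximity` + log-order interior
regularity of the odd Euler–Lagrange equation; origin by the landed `stub_originLayerLemma` (p151407) and the
Poisson identity `Σ_n φ(n) = 0`; edge by the rung-admixture bound (Hadamard `c₊(u_k)² = −ε_k′/2`,
`Σ_k |r_k|²(ε_k − ε₁) ≤ R − ε₁`) + the local archimedean boundary layer (`EdgeSawtooth` margin), applied to
the block's bottom Ritz vector (explicit: a `K × K` eigenproblem with computable entries). -/
def SignFromEnergy (θ Δ : ℝ) (K : ℕ) (r A : ℝ) : Prop :=
  ∀ a : ℝ, A ≤ a → NonResonant (r * Real.exp (-2 * a)) a → TightBlock θ Δ K a → GoodWindow a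

/-- How the line would conclude the crux BY NAME: non-resonant heights are unbounded (RH-free, trivial:
`log ℕ` has gaps `≍ e^{-a}` ≫ `r e^{-2a}`), the shape theorem is RH-free, and `TightBlock` i.o. along
non-resonant heights is the RH-strength input. (Statement only; the composition is two lines of logic.) -/
theorem crux_of_shape (θ Δ : ℝ) (K : ℕ) (r A : ℝ) (hshape : SignFromEnergy θ Δ K r A)
    (hgrid : ∀ B : ℝ, ∃ a : ℝ, B ≤ a ∧ A ≤ a ∧ NonResonant (r * Real.exp (-2 * a)) a ∧ TightBlock θ Δ K a) :
    Theses.OddSector.OddOneSignedWindows := by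
  rw [crux_iff_goodWindow]
  intro B
  obtain ⟨a, hBa, hAa, hnr, htb⟩ := hgrid B
  exact ⟨a, hBa, hshape a hAa hnr htb⟩

end Summit.RiemannHypothesis.RiemannHypothesis.Cruxes.OddOneSignedWindows.ProlateSeed

end
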